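import Summits.RiemannHypothesis.RiemannHypothesis.Theorems.Splittings.SplitXWucK1RF
import HarnessLib

/-!
# Splittings — x-wuc GEN-11 `SplitXWucK1R` (K1′(ℝ) AT THE STAKE) — mechanical carve part 7/14
Continuation of `Summits.RiemannHypothesis.RiemannHypothesis.Theorems.Splittings.SplitXWucK1RF`: byte-identical declaration units of the referee-passed extract `SplitXWucK1R.lean`
sha16 70c8eb2af2868881 (x-wuc g11; ref g10 PASS 2026-08-27T22:59:46Z; RULING #330); open namespaces/sections re-opened with their context.
HONEST LABEL: splitting search over kernel-typed RH-equivalences; K-CERT′ (complex `f`) stays OPEN; nothing here bears on the truth of RH.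
-/
set_option linter.dupNamespace false
noncomputable section
open scoped Classical ComplexConjugate
open Set Filter Topology Complex MeasureTheory
open Real Set Filter Topology
open Real Set MeasureTheory Complex Filter Topology
open scoped Real
namespace Summit.RiemannHypothesis.RiemannHypothesis.Theorems.Splittings.XWucG8
open scoped Classical ComplexConjugate InnerProductSpace
open Set Filter Topology Complex MeasureTheory
open Literature.NumberTheory.LFunctions Literature.NumberTheory.LFunctions.Bombieri2000
open Summit.RiemannHypothesis.RiemannHypothesis.Theses.RuelleBand
open Summit.RiemannHypothesis.RiemannHypothesis.Theorems.Splittings.BombieriTruncEigen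
open Summit.RiemannHypothesis.RiemannHypothesis.Theorems.Splittings.BombieriFozNoDep
open Summit.RiemannHypothesis.RiemannHypothesis.Theorems.Splittings.BombieriTruncGram
open Summit.RiemannHypothesis.RiemannHypothesis.Theorems.Splittings.BombieriTruncPairing
open Summit.RiemannHypothesis.RiemannHypothesis.Theorems.Splittings.BombieriTruncScreening
open Summit.RiemannHypothesis.RiemannHypothesis.Theorems.Splittings.BombieriTruncBandGap
open Summit.RiemannHypothesis.RiemannHypothesis.Theorems.Splittings.BombieriTruncMultiplicity
open Summit.RiemannHypothesis.RiemannHypothesis.Theorems.Splittings.BombieriTruncEventualStrip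
open Summit.RiemannHypothesis.RiemannHypothesis.Theorems.Splittings.BombieriTruncExactness
open Summit.RiemannHypothesis.RiemannHypothesis.Theorems.Splittings.BombieriTruncClump
open Summit.RiemannHypothesis.RiemannHypothesis.Theorems.Splittings.BombieriTruncOffLineSparse
open Summit.RiemannHypothesis.RiemannHypothesis.Theorems.Splittings.BombieriTruncSynthesis
open Summit.RiemannHypothesis.RiemannHypothesis.Theorems.Splittings.BombieriTruncSynthesisScreening
open Summit.RiemannHypothesis.RiemannHypothesis.Theorems.Splittings.BombieriTruncSynthesisRows
open Literature.NumberTheory.DiophantineGeometry (RiemannHypothesisUpTo)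
section Repair
open KCertRidge KCertBridge
/-- **`Φ(κ) = ∫_{[−1,1]} (2 sinh κu)² du`** (`κ ≠ 0`): the constant `Φ` of the whole lane IS the `L²[−1,1]`-energy of the target profile. -/
theorem integral_two_sinh_sq {κ : ℝ} (hκ : κ ≠ 0) :
    ∫ u in Icc (-1 : ℝ) 1, ‖(2 * (Real.sinh (κ * u) : ℂ))‖ ^ 2 = Phi κ := by
  have hnorm : ∀ u : ℝ, ‖(2 * (Real.sinh (κ * u) : ℂ))‖ ^ 2 = 2 * Real.cosh (2 * κ * u) - 2 := by
    intro u
    rw [show (2 * (Real.sinh (κ * u) : ℂ)) = ((2 * Real.sinh (κ * u) : ℝ) : ℂ) by push_cast; ring,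
      Complex.norm_real, Real.norm_eq_abs, sq_abs, mul_pow, show (2:ℝ) ^ 2 * Real.sinh (κ * u) ^ 2
        = 4 * Real.sinh (κ * u) ^ 2 by ring, four_sinh_sq, mul_assoc]
  simp_rw [hnorm]
  rw [integral_Icc_eq_integral_Ioc, ← intervalIntegral.integral_of_le (by norm_num : (-1 : ℝ) ≤ 1)]
  have hderiv : ∀ u ∈ Set.uIcc (-1 : ℝ) 1,
      HasDerivAt (fun u : ℝ ↦ Real.sinh (2 * κ * u) / κ - 2 * u) (2 * Real.cosh (2 * κ * u) - 2) u := by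
    intro u _
    have h1 : HasDerivAt (fun u : ℝ ↦ 2 * κ * u) (2 * κ) u := by
      simpa using (hasDerivAt_id u).const_mul (2 * κ)
    have h2 : HasDerivAt (fun u : ℝ ↦ Real.sinh (2 * κ * u)) (Real.cosh (2 * κ * u) * (2 * κ)) u :=
      (Real.hasDerivAt_sinh _).comp u h1
    have h3 : HasDerivAt (fun u : ℝ ↦ Real.sinh (2 * κ * u) / κ) (2 * Real.cosh (2 * κ * u)) u := by
      have h3' := h2.div_const κ
      refine h3'.congr_deriv ?_
      rw [div_eq_iff hκ]; ring
    have h4 : HasDerivAt (fun u : ℝ ↦ 2 * u) 2 u := by simpa using (hasDerivAt_id u).const_mul 2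
    exact h3.sub h4
  have hint : IntervalIntegrable (fun u : ℝ ↦ 2 * Real.cosh (2 * κ * u) - 2) volume (-1) 1 :=
    (by fun_prop : Continuous fun u : ℝ ↦ 2 * Real.cosh (2 * κ * u) - 2).intervalIntegrable _ _
  rw [intervalIntegral.integral_eq_sub_of_hasDerivAt hderiv hint]
  unfold Phi
  have : Real.sinh (2 * κ * (-1)) = -Real.sinh (2 * κ) := by rw [show 2 * κ * (-1) = -(2 * κ) by ring, Real.sinh_neg]
  rw [this, mul_one]
  field_simp
  ring

/-- **Cauchy–Schwarz for the pairing: `|⟨2 sinh(κ₀·), f⟩|² ≤ Φ(κ₀) · ‖f‖²_{L²[−1,1]}`** (`κ₀ ≠ 0`, `f` continuous). -/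
theorem pairing_sq_le_Phi_mul {κ₀ : ℝ} (hκ₀ : κ₀ ≠ 0) {f : ℝ → ℂ} (hf : Continuous f) :
    ‖∫ u in Icc (-1 : ℝ) 1, 2 * (Real.sinh (κ₀ * u) : ℂ) * f u‖ ^ 2 ≤
      Phi κ₀ * ∫ u in Icc (-1 : ℝ) 1, ‖f u‖ ^ 2 := by
  set μI : Measure ℝ := volume.restrict (Icc (-1 : ℝ) 1) with hμI
  have hgc : Continuous (fun u : ℝ ↦ 2 * (Real.sinh (κ₀ * u) : ℂ)) := by fun_prop
  obtain ⟨G, hGdef⟩ : ∃ G : Lp ℂ 2 μI, G = (memLp_two_Icc_of_continuous hgc).toLp _ := ⟨_, rfl⟩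
  obtain ⟨F, hFdef⟩ : ∃ F : Lp ℂ 2 μI, F = (memLp_two_Icc_of_continuous hf).toLp _ := ⟨_, rfl⟩
  have hGae : (G : ℝ → ℂ) =ᵐ[μI] fun u ↦ 2 * (Real.sinh (κ₀ * u) : ℂ) := by
    rw [hGdef]; exact MemLp.coeFn_toLp _
  have hFae : (F : ℝ → ℂ) =ᵐ[μI] f := by rw [hFdef]; exact MemLp.coeFn_toLp _
  have hGF : ⟪G, F⟫_ℂ = ∫ u in Icc (-1 : ℝ) 1, 2 * (Real.sinh (κ₀ * u) : ℂ) * f u := by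
    rw [inner_eq_integral]
    exact integral_congr_ae (by
      filter_upwards [hGae, hFae] with x hx1 hx2
      rw [hx1, hx2, map_mul, Complex.conj_ofReal, map_ofNat])
  have hG : ‖G‖ ^ 2 = Phi κ₀ := by
    rw [norm_sq_eq_integral, ← integral_two_sinh_sq hκ₀]
    exact integral_congr_ae (by filter_upwards [hGae] with x hx; rw [hx])
  have hF : ‖F‖ ^ 2 = ∫ u in Icc (-1 : ℝ) 1, ‖f u‖ ^ 2 := by
    rw [norm_sq_eq_integral]
    exact integral_congr_ae (by filter_upwards [hFae] with x hx; rw [hx])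
  rw [← hGF, ← hG, ← hF]
  have h := norm_inner_le_norm (𝕜 := ℂ) G F
  have h0 : 0 ≤ ‖⟪G, F⟫_ℂ‖ := norm_nonneg _
  calc ‖⟪G, F⟫_ℂ‖ ^ 2 ≤ (‖G‖ * ‖F‖) ^ 2 := pow_le_pow_left₀ h0 h 2
    _ = ‖G‖ ^ 2 * ‖F‖ ^ 2 := by ring

/-- **SMALL-DENSITY RUNG (all `f`).** For `2πθD ≤ 1` (`θ ≥ 0`, `D > 0`, `ε ≥ 0`) the body `CertBodyR ε κ₀ D Lc δ θ f` holds for EVERY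
continuous `f` with the EMPTY certificate: the ridge alone pays, by Cauchy–Schwarz.  (So the repaired node has content only at densities
`D > 1/(2πθ)`: `> 3.79` at `θ = 0.042`, `> 2.84` at `θ = 0.056`.) -/
theorem certBodyR_of_small_density {ε κ₀ D Lc δ θ : ℝ} (hε : 0 ≤ ε) (hκ₀ : 0 < κ₀) (hD : 0 < D) (hθ : 0 ≤ θ)
    (hθD : 2 * Real.pi * θ * D ≤ 1) (f : ℝ → ℂ) (hf : Continuous f) : CertBodyR ε κ₀ D Lc δ θ f := by
  refine ⟨0, Fin.elim0, Fin.elim0, Fin.elim0, fun i ↦ Fin.elim0 i, fun lam κ _ _ ↦ ?_, ?_⟩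
  · simp only [Finset.univ_eq_empty, Finset.filter_empty, Finset.sum_empty]; positivity
  simp only [Finset.univ_eq_empty, Finset.sum_empty, add_zero]
  have hCS := pairing_sq_le_Phi_mul hκ₀.ne' hf
  have hΦ : 0 ≤ Phi κ₀ := Phi_nonneg_of_pos hκ₀
  set P : ℝ := ‖∫ u in Icc (-1 : ℝ) 1, 2 * (Real.sinh (κ₀ * u) : ℂ) * f u‖ ^ 2
  set R : ℝ := ∫ u in Icc (-1 : ℝ) 1, ‖f u‖ ^ 2
  have hR : 0 ≤ R := integral_nonneg fun u ↦ by positivity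
  have hP : 0 ≤ P := by positivity
  -- 2πθ·P ≤ 2πθ·Φ·R = (2πθD)·Φ·(R/D) ≤ Φ·(R/D) ≤ (1+ε)Φ·(R/D)
  have h1 : 2 * Real.pi * θ * P ≤ 2 * Real.pi * θ * (Phi κ₀ * R) :=
    mul_le_mul_of_nonneg_left hCS (by positivity)
  have h2 : 2 * Real.pi * θ * (Phi κ₀ * R) = (2 * Real.pi * θ * D) * (Phi κ₀ * (R / D)) := by
    field_simp
  have h3 : (2 * Real.pi * θ * D) * (Phi κ₀ * (R / D)) ≤ 1 * (Phi κ₀ * (R / D)) :=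
    mul_le_mul_of_nonneg_right hθD (by positivity)
  have h4 : 1 * (Phi κ₀ * (R / D)) ≤ (1 + ε) * Phi κ₀ * (R / D) := by
    rw [one_mul, mul_assoc]; exact le_mul_of_one_le_left (by positivity) (by linarith)
  linarith

end Repair
end Summit.RiemannHypothesis.RiemannHypothesis.Theorems.Splittings.XWucG8
namespace Summit.RiemannHypothesis.RiemannHypothesis.Theorems.Splittings.XWucG8
open scoped Classical ComplexConjugate
open Set Filter Topology Complex MeasureTheory
section OddReduction
open SignConeRung
/-- reflection invariance of the real integral over `[−1,1]` -/
theorem integral_reflect_real (h : ℝ → ℝ) : ∫ u in Icc (-1 : ℝ) 1, h (-u) = ∫ u in Icc (-1 : ℝ) 1, h u := by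
  rw [integral_Icc_eq_integral_Ioc, integral_Icc_eq_integral_Ioc, ← intervalIntegral.integral_of_le (by norm_num),
    ← intervalIntegral.integral_of_le (by norm_num), intervalIntegral.integral_comp_neg]
  norm_num

/-- pointwise parallelogram bound for the odd part -/
theorem norm_sq_oddPart_le (f : ℝ → ℂ) (u : ℝ) : ‖oddPart f u‖ ^ 2 ≤ (‖f u‖ ^ 2 + ‖f (-u)‖ ^ 2) / 2 := by
  have h1 : ‖oddPart f u‖ = ‖f u - f (-u)‖ / 2 := by
    simp only [oddPart, norm_div]
    norm_num
  have h2 : ‖f u - f (-u)‖ ≤ ‖f u‖ + ‖f (-u)‖ := norm_sub_le _ _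
  have h3 : ‖f u - f (-u)‖ ^ 2 ≤ (‖f u‖ + ‖f (-u)‖) ^ 2 := pow_le_pow_left₀ (norm_nonneg _) h2 2
  rw [h1]
  nlinarith [norm_nonneg (f u), norm_nonneg (f (-u)), sq_nonneg (‖f u‖ - ‖f (-u)‖)]

/-- **`‖f_odd‖²_{L²[−1,1]} ≤ ‖f‖²_{L²[−1,1]}`** for every continuous `f` (complex values allowed). -/
theorem integral_norm_sq_oddPart_le {f : ℝ → ℂ} (hfc : Continuous f) :
    ∫ u in Icc (-1 : ℝ) 1, ‖oddPart f u‖ ^ 2 ≤ ∫ u in Icc (-1 : ℝ) 1, ‖f u‖ ^ 2 := by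
  have hoc : Continuous (oddPart f) := oddPart_continuous hfc
  have hfn : Continuous fun u : ℝ ↦ f (-u) := hfc.comp continuous_neg
  have hi1 : IntegrableOn (fun u ↦ ‖oddPart f u‖ ^ 2) (Icc (-1 : ℝ) 1) := (hoc.norm.pow 2).integrableOn_Icc
  have hi3 : IntegrableOn (fun u ↦ ‖f u‖ ^ 2) (Icc (-1 : ℝ) 1) := (hfc.norm.pow 2).integrableOn_Icc
  have hi4 : IntegrableOn (fun u ↦ ‖f (-u)‖ ^ 2) (Icc (-1 : ℝ) 1) := (hfn.norm.pow 2).integrableOn_Icc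
  have hi2 : IntegrableOn (fun u ↦ (‖f u‖ ^ 2 + ‖f (-u)‖ ^ 2) / 2) (Icc (-1 : ℝ) 1) := (hi3.add hi4).div_const 2
  calc ∫ u in Icc (-1 : ℝ) 1, ‖oddPart f u‖ ^ 2
      ≤ ∫ u in Icc (-1 : ℝ) 1, (‖f u‖ ^ 2 + ‖f (-u)‖ ^ 2) / 2 := setIntegral_mono hi1 hi2 (fun u ↦ norm_sq_oddPart_le f u)
    _ = ((∫ u in Icc (-1 : ℝ) 1, ‖f u‖ ^ 2) + ∫ u in Icc (-1 : ℝ) 1, ‖f (-u)‖ ^ 2) / 2 := by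
        rw [integral_div, integral_add hi3 hi4]
    _ = ∫ u in Icc (-1 : ℝ) 1, ‖f u‖ ^ 2 := by
        rw [integral_reflect_real (fun u ↦ ‖f u‖ ^ 2)]; ring

/-- test functions real-valued on `[−1,1]` -/
def RealVal : Set (ℝ → ℂ) := {f | ∀ u ∈ Icc (-1 : ℝ) 1, (f u).im = 0}

end OddReduction
end Summit.RiemannHypothesis.RiemannHypothesis.Theorems.Splittings.XWucG8
open Real Set MeasureTheory Complex Filter Topology
open scoped Real
namespace Summit.RiemannHypothesis.RiemannHypothesis.Theorems.Splittings.XWucG8.DSLine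
open scoped ComplexConjugate
section zerocmp
end zerocmp
section parseval
/-- the modulated test function `u ↦ g(u) cosh(tu) e^{icu}` whose period-2 Fourier coefficients are the lattice samples. -/
noncomputable def modFun (g : ℝ → ℂ) (c t : ℝ) : ℝ → ℂ :=
  fun x => g x * (Real.cosh (t * x) : ℂ) * cexp (I * (c : ℂ) * x)

/-- `continuous_modFun` — helper of the x-wuc GEN-11 chain «K1′(ℝ) at the stake» (verbatim from the referee-passed extract `SplitXWucK1R.lean` 70c8eb2af2868881; role: see the module docstring). -/
theorem continuous_modFun {g : ℝ → ℂ} (hg : Continuous g) (c t : ℝ) : Continuous (modFun g c t) := by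
  unfold modFun; fun_prop

/-- `norm_modFun` — helper of the x-wuc GEN-11 chain «K1′(ℝ) at the stake» (verbatim from the referee-passed extract `SplitXWucK1R.lean` 70c8eb2af2868881; role: see the module docstring). -/
theorem norm_modFun (g : ℝ → ℂ) (c t x : ℝ) :
    ‖modFun g c t x‖ = ‖g x * (Real.cosh (t * x) : ℂ)‖ := by
  unfold modFun
  rw [norm_mul, show I * (c : ℂ) * x = ((c * x : ℝ) : ℂ) * I by push_cast; ring, Complex.norm_exp_ofReal_mul_I,
    mul_one]

/-- `memLp_modFun` — helper of the x-wuc GEN-11 chain «K1′(ℝ) at the stake» (verbatim from the referee-passed extract `SplitXWucK1R.lean` 70c8eb2af2868881; role: see the module docstring). -/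
theorem memLp_modFun {g : ℝ → ℂ} (hg : Continuous g) (c t : ℝ) :
    MemLp (modFun g c t) 2 (volume.restrict (Ioc (-1 : ℝ) 1)) := by
  have hc := continuous_modFun hg c t
  obtain ⟨B, hB⟩ := IsCompact.exists_bound_of_continuousOn isCompact_Icc
    (hc.continuousOn : ContinuousOn (modFun g c t) (Icc (-1 : ℝ) 1))
  have hbd : ∀ᵐ x ∂(volume.restrict (Ioc (-1 : ℝ) 1)), ‖modFun g c t x‖ ≤ B := by
    rw [ae_restrict_iff' measurableSet_Ioc]
    exact Filter.Eventually.of_forall (fun x hx => hB x ⟨hx.1.le, hx.2⟩)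
  have htop : MemLp (modFun g c t) ⊤ (volume.restrict (Ioc (-1 : ℝ) 1)) :=
    memLp_top_of_bound hc.aestronglyMeasurable B hbd
  exact htop.mono_exponent le_top

/-- the `n`-th period-2 Fourier coefficient of `modFun g c t` on `(-1,1]` is `½ · tfT g (c − πn) t`. -/
theorem fourierCoeffOn_modFun (g : ℝ → ℂ) (c t : ℝ) (n : ℤ) :
    fourierCoeffOn (by norm_num : (-1 : ℝ) < 1) (modFun g c t) n = (1 / 2 : ℂ) * tfT g (c - π * n) t := by
  rw [fourierCoeffOn_eq_integral, CoshKernel.tfT_interval]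
  rw [show (1 / ((1 : ℝ) - -1) : ℝ) = 1 / 2 by norm_num]
  rw [Complex.real_smul]
  push_cast
  congr 1
  apply intervalIntegral.integral_congr
  intro x _
  simp only [modFun, smul_eq_mul, fourier_coe_apply]
  have e3 : cexp (2 * π * I * ((-n : ℤ) : ℂ) * (x : ℂ) / (((1 : ℝ) - -1 : ℝ) : ℂ)) = cexp (-(π * n * x) * I) := by
    congr 1; push_cast; field_simp; ring
  rw [e3, show I * ((c : ℂ) - (π : ℂ) * (n : ℂ)) * (x : ℂ) = I * (c : ℂ) * x + -(π * n * x) * I by ring,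
    Complex.exp_add]
  push_cast
  ring

/-- **(P) Parseval on the shifted π-lattice.**
`Σ_{n ∈ ℤ} ‖tfT g (c + πn) t‖² = 2 ∫_{[−1,1]} ‖g(u) cosh(tu)‖² du` for continuous `g` and all real `c, t`. -/
theorem hasSum_norm_sq_tfT (g : ℝ → ℂ) (hg : Continuous g) (c t : ℝ) :
    HasSum (fun n : ℤ => ‖tfT g (c + π * n) t‖ ^ 2)
      (2 * ∫ u in Icc (-1 : ℝ) 1, ‖g u * (Real.cosh (t * u) : ℂ)‖ ^ 2) := by
  have hP := hasSum_sq_fourierCoeffOn (by norm_num : (-1 : ℝ) < 1) (memLp_modFun hg c t)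
  simp_rw [fourierCoeffOn_modFun, norm_mul] at hP
  have hval : ((1 : ℝ) - -1)⁻¹ • ∫ x in (-1 : ℝ)..1, ‖modFun g c t x‖ ^ 2
      = (1 / 2) * ∫ u in Icc (-1 : ℝ) 1, ‖g u * (Real.cosh (t * u) : ℂ)‖ ^ 2 := by
    rw [intervalIntegral.integral_of_le (by norm_num), ← integral_Icc_eq_integral_Ioc, smul_eq_mul]
    simp_rw [norm_modFun]
    norm_num
  rw [hval] at hP
  have hn : ‖(1 / 2 : ℂ)‖ = 1 / 2 := by norm_num
  simp_rw [hn, mul_pow] at hP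
  have h4 := hP.mul_left 4
  have e1 : (fun i : ℤ => 4 * ((1 / 2 : ℝ) ^ 2 * ‖tfT g (c - π * i) t‖ ^ 2))
      = (fun n : ℤ => ‖tfT g (c + π * n) t‖ ^ 2) ∘ (Equiv.neg ℤ) := by
    funext i
    simp only [Function.comp_apply, Equiv.neg_apply, Int.cast_neg]
    rw [show c + π * -(i : ℝ) = c - π * i by ring]
    ring
  rw [e1, Equiv.hasSum_iff] at h4
  rwa [show (4 : ℝ) * (1 / 2 * ∫ u in Icc (-1 : ℝ) 1, ‖g u * (Real.cosh (t * u) : ℂ)‖ ^ 2)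
      = 2 * ∫ u in Icc (-1 : ℝ) 1, ‖g u * (Real.cosh (t * u) : ℂ)‖ ^ 2 by ring] at h4

/-- (P), finite form: any finite family of samples on a shifted π-lattice has energy at most the Parseval value. -/
theorem sum_norm_sq_tfT_le (g : ℝ → ℂ) (hg : Continuous g) (c t : ℝ) (s : Finset ℤ) :
    ∑ n ∈ s, ‖tfT g (c + π * n) t‖ ^ 2 ≤ 2 * ∫ u in Icc (-1 : ℝ) 1, ‖g u * (Real.cosh (t * u) : ℂ)‖ ^ 2 :=
  sum_le_hasSum s (fun n _ => by positivity) (hasSum_norm_sq_tfT g hg c t)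

/-- the weight bound `‖g(u) cosh(tu)‖² ≤ cosh²t ‖g(u)‖²` on `[−1,1]`. -/
theorem norm_sq_mul_cosh_le (g : ℝ → ℂ) (t : ℝ) {u : ℝ} (hu : u ∈ Icc (-1 : ℝ) 1) :
    ‖g u * (Real.cosh (t * u) : ℂ)‖ ^ 2 ≤ Real.cosh t ^ 2 * ‖g u‖ ^ 2 := by
  rw [norm_mul, Complex.norm_real, Real.norm_eq_abs, abs_of_pos (Real.cosh_pos _), mul_pow]
  have h1 : Real.cosh (t * u) ≤ Real.cosh t := by
    rw [Real.cosh_le_cosh, abs_mul]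
    calc |t| * |u| ≤ |t| * 1 := mul_le_mul_of_nonneg_left (abs_le.mpr ⟨hu.1, hu.2⟩) (abs_nonneg t)
      _ = |t| := mul_one _
  have h2 : Real.cosh (t * u) ^ 2 ≤ Real.cosh t ^ 2 :=
    pow_le_pow_left₀ (Real.cosh_pos _).le h1 2
  nlinarith [sq_nonneg ‖g u‖, h2]

/-- **(P′) energy budget of the lattice samples:** `Σ_{n∈s} ‖tfT g (c + πn) t‖² ≤ 2 cosh²t · ∫_{[−1,1]} ‖g‖²`
(`2 cosh²½ ≤ 2.55` on the node's range `κ = t ∈ [0,½]`). -/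
theorem sum_norm_sq_tfT_le_cosh_sq (g : ℝ → ℂ) (hg : Continuous g) (c t : ℝ) (s : Finset ℤ) :
    ∑ n ∈ s, ‖tfT g (c + π * n) t‖ ^ 2 ≤ 2 * Real.cosh t ^ 2 * ∫ u in Icc (-1 : ℝ) 1, ‖g u‖ ^ 2 := by
  have h1 : IntegrableOn (fun u : ℝ => ‖g u * (Real.cosh (t * u) : ℂ)‖ ^ 2) (Icc (-1 : ℝ) 1) :=
    (by fun_prop : Continuous fun u : ℝ => ‖g u * (Real.cosh (t * u) : ℂ)‖ ^ 2).integrableOn_Icc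
  have h2 : IntegrableOn (fun u : ℝ => Real.cosh t ^ 2 * ‖g u‖ ^ 2) (Icc (-1 : ℝ) 1) :=
    (by fun_prop : Continuous fun u : ℝ => Real.cosh t ^ 2 * ‖g u‖ ^ 2).integrableOn_Icc
  have hmono : ∫ u in Icc (-1 : ℝ) 1, ‖g u * (Real.cosh (t * u) : ℂ)‖ ^ 2
      ≤ ∫ u in Icc (-1 : ℝ) 1, Real.cosh t ^ 2 * ‖g u‖ ^ 2 :=
    setIntegral_mono_on h1 h2 measurableSet_Icc (fun u hu => norm_sq_mul_cosh_le g t hu)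
  rw [integral_const_mul] at hmono
  calc ∑ n ∈ s, ‖tfT g (c + π * n) t‖ ^ 2
      ≤ 2 * ∫ u in Icc (-1 : ℝ) 1, ‖g u * (Real.cosh (t * u) : ℂ)‖ ^ 2 := sum_norm_sq_tfT_le g hg c t s
    _ ≤ 2 * (Real.cosh t ^ 2 * ∫ u in Icc (-1 : ℝ) 1, ‖g u‖ ^ 2) :=
        mul_le_mul_of_nonneg_left hmono (by norm_num)
    _ = 2 * Real.cosh t ^ 2 * ∫ u in Icc (-1 : ℝ) 1, ‖g u‖ ^ 2 := by ring

end parseval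
section dentfloor
end dentfloor
end Summit.RiemannHypothesis.RiemannHypothesis.Theorems.Splittings.XWucG8.DSLine
namespace Summit.RiemannHypothesis.RiemannHypothesis.Theorems.Splittings.XWucG8
end Summit.RiemannHypothesis.RiemannHypothesis.Theorems.Splittings.XWucG8
namespace Summit.RiemannHypothesis.RiemannHypothesis.Theorems.Splittings.XWucG8
open scoped Classical
open Set Filter Topology Complex MeasureTheory
section FloorCert
end FloorCert
end Summit.RiemannHypothesis.RiemannHypothesis.Theorems.Splittings.XWucG8
namespace Summit.RiemannHypothesis.RiemannHypothesis.Theorems.Splittings.XWucG8.DSLine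
open Real Set MeasureTheory Complex Filter Topology
open scoped Real
section oversampled
end oversampled
end Summit.RiemannHypothesis.RiemannHypothesis.Theorems.Splittings.XWucG8.DSLine
namespace Summit.RiemannHypothesis.RiemannHypothesis.Theorems.Splittings.XWucG8
end Summit.RiemannHypothesis.RiemannHypothesis.Theorems.Splittings.XWucG8
namespace Summit.RiemannHypothesis.RiemannHypothesis.Theorems.Splittings.XWucG8.DSLine
open Real Set MeasureTheory Complex Filter Topology
open scoped Real
section inband
end inband
end Summit.RiemannHypothesis.RiemannHypothesis.Theorems.Splittings.XWucG8.DSLine
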